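import Summits.Ventures.CertifiedArithmetic.LowPrec.PatternEnvelopeAdd

/-!
# Pattern route of Theorem E5′: PER-BAND envelope constants of products and sums as a proved
# algorithm (normal bands, relative-error columns, the four roundings)

HONEST FRAMING (venture CertifiedArithmetic / cell `pub-lowprec`): certified error envelopes and
provably optimal rounding/accumulation schemes for low-precision formats under stated cost models;
every table by two implementations; no hardware or vendor claims.

THEOREMS-R1-BANDS (Theorem E5′; fourth route `code/enum/bandconst.py`, pre-registered
`certs/enum/PREDICTIONS-BANDCONST*.json`, certified rows observed = predicted `2940/2940` on the
FP6/FP4 campaign): for every exponent band of the destination the maximal relative error of a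
table is the maximum of the closed-form pattern error over the realisable patterns PLACED IN THAT
BAND. This file proves the bookkeeping for the NORMAL bands `β = 0, 1, …` of `R`
(`2^(m+β) · quantum_R ≤ |t| < 2^(m+β+1) · quantum_R`, `|t| ≤ maxRat_R`; band `β` is the binade of
exponent `e = β + 1 - bias_R` in the tables), for products AND sums and all four roundings at
once: `Format.bandB` (Boolean band test in natural-number arithmetic, `bandB_iff_of_eq`), the
notion of a ROUNDING WITH A PATTERN BRIDGE `PatBridge R F` (rounding, closed-form pattern error,
sign of attainment, the two bridge facts) with the four instances `MiniFloat.bridgeNE / bridgeTZ /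
bridgeRD / bridgeRU` (from `PatternBridge.lean`), the band pattern lists `mulBandErrs`,
`addBandErrs` and constants `envconstMulBandNE/TZ/Dir`, `envconstAddBandNE/TZ/Dir`, and the two
schemas per operation: SOUND on the band (`MiniFloat.mul_band_le`, `add_band_le`) and ATTAINED in
the band once one pattern is placed there (`mul_band_attained`, `add_band_attained`).
The subnormal bands and the absolute / ulp columns of THEOREMS-R1-BANDS are not treated here.
Instances for the FP6/FP4 keys: `PatternBandsFP6FP4.lean`; FP8 keys are not instantiated (held).

Placement: venture development under `Summits/Ventures/CertifiedArithmetic/` (operator decision,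
BOARD.md); new work of the venture, elementary ([folklore]; model [cite: Higham2002ASNA, §2.1]).
-/

namespace Literature.ComputerArithmetic.FloatingPoint

namespace Format

/-- BAND TEST: the magnitude `N · 2^E` quanta of `R` lies in the `β`-th binade of the normal range,
`2^(m+β) ≤ N · 2^E < 2^(m+β+1)`, and in range, `N · 2^E ≤ maxScaled` — natural-number arithmetic on
both signs of `E` (Boolean, kernel-reducible). [folklore] -/
def bandB (R : Format) (β N : ℕ) : ℤ → Bool
  | Int.ofNat e => decide (2 ^ (R.manBits + β) ≤ N * 2 ^ e ∧ N * 2 ^ e < 2 ^ (R.manBits + β + 1) ∧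
      N * 2 ^ e ≤ R.maxScaled)
  | Int.negSucc e => decide (2 ^ (R.manBits + β) * 2 ^ (e + 1) ≤ N ∧
      N < 2 ^ (R.manBits + β + 1) * 2 ^ (e + 1) ∧ N ≤ R.maxScaled * 2 ^ (e + 1))

/-- `bandB` over the rationals: `2^(m+β) ≤ N · 2^E < 2^(m+β+1)` and `N · 2^E ≤ maxScaled`.
[folklore] -/
theorem bandB_eq_true_iff {R : Format} {β N : ℕ} {E : ℤ} : R.bandB β N E = true ↔
    (2 : ℚ) ^ (R.manBits + β) ≤ (N : ℚ) * 2 ^ E ∧ (N : ℚ) * 2 ^ E < 2 ^ (R.manBits + β + 1) ∧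
      (N : ℚ) * 2 ^ E ≤ (R.maxScaled : ℚ) := by
  cases E with
  | ofNat e =>
    rw [bandB, decide_eq_true_iff, Int.ofNat_eq_natCast, zpow_natCast]
    constructor
    · rintro ⟨h1, h2, h3⟩
      exact ⟨by exact_mod_cast h1, by exact_mod_cast h2, by exact_mod_cast h3⟩
    · rintro ⟨h1, h2, h3⟩
      exact ⟨by exact_mod_cast h1, by exact_mod_cast h2, by exact_mod_cast h3⟩
  | negSucc e =>
    have hp : (0 : ℚ) < 2 ^ (e + 1) := by positivity
    rw [bandB, decide_eq_true_iff, zpow_negSucc, ← div_eq_mul_inv, le_div_iff₀ hp,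
      div_lt_iff₀ hp, div_le_iff₀ hp]
    constructor
    · rintro ⟨h1, h2, h3⟩
      exact ⟨by exact_mod_cast h1, by exact_mod_cast h2, by exact_mod_cast h3⟩
    · rintro ⟨h1, h2, h3⟩
      exact ⟨by exact_mod_cast h1, by exact_mod_cast h2, by exact_mod_cast h3⟩

/-- `bandB β N E` says that a value of magnitude `N · 2^E · quantum_R` lies in band `β` of the
normal range: `2^(m+β) · quantum_R ≤ |t| < 2^(m+β+1) · quantum_R` and `|t| ≤ maxRat_R`. [folklore] -/
theorem bandB_iff_of_eq {R : Format} {t : ℚ} {β N : ℕ} {E : ℤ}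
    (ht : |t| = (N : ℚ) * 2 ^ E * R.quantum) :
    R.bandB β N E = true ↔ 2 ^ (R.manBits + β) * R.quantum ≤ |t| ∧
      |t| < 2 ^ (R.manBits + β + 1) * R.quantum ∧ |t| ≤ R.maxRat := by
  have hq := R.quantum_pos
  rw [bandB_eq_true_iff, ht, Format.maxRat]
  constructor
  · rintro ⟨h1, h2, h3⟩
    exact ⟨mul_le_mul_of_nonneg_right h1 hq.le, mul_lt_mul_of_pos_right h2 hq,
      mul_le_mul_of_nonneg_right h3 hq.le⟩
  · rintro ⟨h1, h2, h3⟩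
    exact ⟨le_of_mul_le_mul_right h1 hq, lt_of_mul_lt_mul_right h2 hq.le,
      le_of_mul_le_mul_right h3 hq⟩

/-- A value in a normal band is in the normal range. [folklore] -/
theorem normal_of_band {R : Format} {t : ℚ} {β : ℕ}
    (h : 2 ^ (R.manBits + β) * R.quantum ≤ |t|) : 2 ^ R.manBits * R.quantum ≤ |t| :=
  le_trans (mul_le_mul_of_nonneg_right
    (pow_le_pow_right₀ (by norm_num) (Nat.le_add_right _ _)) R.quantum_pos.le) h

end Format

open Format

/-- A ROUNDING WITH A PATTERN BRIDGE at destination `R` and fuel `F`: the rounding `fl`, its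
closed-form pattern error `err R F N`, the sign `sgn N` at which pattern `N` attains it, and the
two bridge facts on the normal range (`PatternBridge.lean`): relative error `≤ err` always, `= err`
at the prescribed sign. [folklore] -/
structure PatBridge (R : Format) (F : ℕ) where
  /-- The rounding into `R`. -/
  fl : ℚ → MiniFloat R
  /-- The closed-form pattern error (used as `err R F N`). -/
  err : Format → ℕ → ℕ → ℚ
  /-- The sign (`true` = negative) at which pattern `N` attains `err R F N`. -/
  sgn : ℕ → Bool
  /-- Pattern errors are nonnegative. -/
  err_nonneg : ∀ N, 0 ≤ err R F N
  /-- Bridge, inequality: on the normal range the relative error is at most the pattern error. -/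
  rel_le : ∀ (t : ℚ) (N : ℕ) (e : ℤ), N < 2 ^ (R.manBits + 1 + F) →
    |t| = (N : ℚ) * 2 ^ e * R.quantum → 2 ^ R.manBits * R.quantum ≤ |t| → |t| ≤ R.maxRat →
      |t - (fl t).toRat| / |t| ≤ err R F N
  /-- Bridge, equality at the prescribed sign. -/
  rel_eq : ∀ (t : ℚ) (N : ℕ) (e : ℤ), t ≠ 0 → (t < 0 ↔ sgn N = true) →
    N < 2 ^ (R.manBits + 1 + F) → |t| = (N : ℚ) * 2 ^ e * R.quantum →
      2 ^ R.manBits * R.quantum ≤ |t| → |t| ≤ R.maxRat → |t - (fl t).toRat| / |t| = err R F N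

namespace MiniFloat

/-- ROUND TO NEAREST EVEN with its pattern bridge (`relErr_roundNE_of_scaled`). [folklore] -/
def bridgeNE (R : Format) (F : ℕ) : PatBridge R F where
  fl := roundNE R
  err := patRelErrNE
  sgn := fun _ => false
  err_nonneg := fun N => patRelErrNE_nonneg F N
  rel_le := fun _ _ _ hF ht hlo hhi => (relErr_roundNE_of_scaled hF ht hlo hhi).le
  rel_eq := fun _ _ _ _ _ hF ht hlo hhi => relErr_roundNE_of_scaled hF ht hlo hhi

/-- ROUND TOWARD ZERO with its pattern bridge (`relErr_roundTowardZero_of_scaled`). [folklore] -/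
def bridgeTZ (R : Format) (F : ℕ) : PatBridge R F where
  fl := roundTowardZero R
  err := patRelErrTZ
  sgn := fun _ => false
  err_nonneg := fun N => patRelErrTZ_nonneg F N
  rel_le := fun _ _ _ hF ht hlo hhi => (relErr_roundTowardZero_of_scaled hF ht hlo hhi).le
  rel_eq := fun _ _ _ _ _ hF ht hlo hhi => relErr_roundTowardZero_of_scaled hF ht hlo hhi

/-- ROUND DOWN with its pattern bridge: error `max(TZ, AW)`, attained at a negative argument when
the away error exceeds the toward-zero error. [folklore] -/
def bridgeRD (R : Format) (F : ℕ) : PatBridge R F where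
  fl := roundDown R
  err := patRelErrDir
  sgn := fun N => decide (R.patRelErrTZ F N < R.patRelErrAW F N)
  err_nonneg := fun N => patRelErrDir_nonneg F N
  rel_le := fun t _ _ hF ht hlo hhi => by
    rcases lt_or_gt_of_ne (ne_zero_of_normal hlo) with hneg | hpos
    · rw [relErr_roundDown_of_scaled_neg hneg hF ht hlo hhi]; exact le_max_right _ _
    · rw [relErr_roundDown_of_scaled_pos hpos hF ht hlo hhi]; exact le_max_left _ _
  rel_eq := fun t N _ hne0 hsgn hF ht hlo hhi => by
    by_cases h : R.patRelErrTZ F N < R.patRelErrAW F N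
    · rw [relErr_roundDown_of_scaled_neg (hsgn.mpr (decide_eq_true h)) hF ht hlo hhi]
      exact (max_eq_right h.le).symm
    · have hpos : 0 < t := by
        rcases lt_or_gt_of_ne hne0 with hneg | hpos
        · exact absurd (of_decide_eq_true (hsgn.mp hneg)) h
        · exact hpos
      rw [relErr_roundDown_of_scaled_pos hpos hF ht hlo hhi]
      exact (max_eq_left (not_lt.mp h)).symm

/-- ROUND UP with its pattern bridge (mirror image of round down). [folklore] -/
def bridgeRU (R : Format) (F : ℕ) : PatBridge R F where
  fl := roundUp R
  err := patRelErrDir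
  sgn := fun N => decide (R.patRelErrAW F N < R.patRelErrTZ F N)
  err_nonneg := fun N => patRelErrDir_nonneg F N
  rel_le := fun t _ _ hF ht hlo hhi => by
    rcases lt_or_gt_of_ne (ne_zero_of_normal hlo) with hneg | hpos
    · rw [relErr_roundUp_of_scaled_neg hneg hF ht hlo hhi]; exact le_max_left _ _
    · rw [relErr_roundUp_of_scaled_pos hpos hF ht hlo hhi]; exact le_max_right _ _
  rel_eq := fun t N _ hne0 hsgn hF ht hlo hhi => by
    by_cases h : R.patRelErrAW F N < R.patRelErrTZ F N
    · rw [relErr_roundUp_of_scaled_neg (hsgn.mpr (decide_eq_true h)) hF ht hlo hhi]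
      exact (max_eq_left h.le).symm
    · have hpos : 0 < t := by
        rcases lt_or_gt_of_ne hne0 with hneg | hpos
        · exact absurd (of_decide_eq_true (hsgn.mp hneg)) h
        · exact hpos
      rw [relErr_roundUp_of_scaled_pos hpos hF ht hlo hhi]
      exact (max_eq_right (not_lt.mp h)).symm

end MiniFloat

/-! ### Products per band -/

/-- THE REALISABLE PRODUCT PATTERNS PLACED IN BAND `β`, with their errors. [folklore] -/
def mulBandErrs (err : Format → ℕ → ℕ → ℚ) (X Y R : Format) (β : ℕ) : List ℚ :=
  X.sigShifts.flatMap fun p => Y.sigShifts.flatMap fun q =>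
    if R.bandB β (p.1 * q.1) (((p.2 + q.2 : ℕ) : ℤ) + mulExpOffset X Y R) then
      [err R (mulFuel X Y) (p.1 * q.1)] else []

/-- Membership in `mulBandErrs`. [folklore] -/
theorem mem_mulBandErrs {err : Format → ℕ → ℕ → ℚ} {X Y R : Format} {β : ℕ} {c : ℚ} :
    c ∈ mulBandErrs err X Y R β ↔ ∃ k₁ j₁ k₂ j₂ : ℕ, (k₁, j₁) ∈ X.sigShifts ∧
      (k₂, j₂) ∈ Y.sigShifts ∧
      R.bandB β (k₁ * k₂) (((j₁ + j₂ : ℕ) : ℤ) + mulExpOffset X Y R) = true ∧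
      c = err R (mulFuel X Y) (k₁ * k₂) := by
  simp only [mulBandErrs, List.mem_flatMap]
  constructor
  · rintro ⟨⟨k₁, j₁⟩, h1, ⟨k₂, j₂⟩, h2, h⟩
    split_ifs at h with hp
    · exact ⟨k₁, j₁, k₂, j₂, h1, h2, hp, by simpa using h⟩
    · simp at h
  · rintro ⟨k₁, j₁, k₂, j₂, h1, h2, hp, rfl⟩
    exact ⟨(k₁, j₁), h1, (k₂, j₂), h2, by rw [if_pos hp]; simp⟩

/-- BAND CONSTANT, products, nearest. [folklore] -/
def envconstMulBandNE (X Y R : Format) (β : ℕ) : ℚ := maxList0 (mulBandErrs patRelErrNE X Y R β)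

/-- BAND CONSTANT, products, toward zero. [folklore] -/
def envconstMulBandTZ (X Y R : Format) (β : ℕ) : ℚ := maxList0 (mulBandErrs patRelErrTZ X Y R β)

/-- BAND CONSTANT, products, round down / round up. [folklore] -/
def envconstMulBandDir (X Y R : Format) (β : ℕ) : ℚ :=
  maxList0 (mulBandErrs patRelErrDir X Y R β)

namespace MiniFloat

variable {X Y : Format}

/-- The pattern of a product in band `β` is listed there. [folklore] -/
theorem mem_mulBandErrs_of_band (err : Format → ℕ → ℕ → ℚ) (R : Format) {β : ℕ}
    (a : MiniFloat X) (b : MiniFloat Y)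
    (h1 : 2 ^ (R.manBits + β) * R.quantum ≤ |a.toRat * b.toRat|)
    (h2 : |a.toRat * b.toRat| < 2 ^ (R.manBits + β + 1) * R.quantum)
    (h3 : |a.toRat * b.toRat| ≤ R.maxRat) :
    err R (mulFuel X Y) (a.sig * b.sig) ∈ mulBandErrs err X Y R β := by
  rw [mem_mulBandErrs]
  exact ⟨a.sig, a.bshift, b.sig, b.bshift,
    mem_sigShifts.mpr ⟨a.sig_lt, a.bshift_le, a.sig_mul_pow_le_maxScaled⟩,
    mem_sigShifts.mpr ⟨b.sig_lt, b.bshift_le, b.sig_mul_pow_le_maxScaled⟩,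
    (bandB_iff_of_eq (abs_mul_toRat_eq R a b)).mpr ⟨h1, h2, h3⟩, rfl⟩

/-- SOUNDNESS PER BAND (products): for a rounding with a pattern bridge, every product of data
in band `β` has error at most `maxList0 (mulBandErrs err X Y R β) · |a·b|`. [folklore] -/
theorem mul_band_le (R : Format) (B : PatBridge R (mulFuel X Y)) (β : ℕ) (a : MiniFloat X)
    (b : MiniFloat Y) (h1 : 2 ^ (R.manBits + β) * R.quantum ≤ |a.toRat * b.toRat|)
    (h2 : |a.toRat * b.toRat| < 2 ^ (R.manBits + β + 1) * R.quantum)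
    (h3 : |a.toRat * b.toRat| ≤ R.maxRat) :
    |(B.fl (a.toRat * b.toRat)).toRat - a.toRat * b.toRat|
      ≤ maxList0 (mulBandErrs B.err X Y R β) * |a.toRat * b.toRat| := by
  have hlo := normal_of_band h1
  have hpos : 0 < |a.toRat * b.toRat| := abs_pos.mpr (ne_zero_of_normal hlo)
  have hrel := B.rel_le _ _ _ (mul_lt_pow_mulFuel R a.sig_lt b.sig_lt) (abs_mul_toRat_eq R a b)
    hlo h3
  exact abs_sub_le_mul_of_relErr_le hpos
    (le_trans hrel (le_maxList0_of_mem (mem_mulBandErrs_of_band B.err R a b h1 h2 h3)))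

/-- ATTAINMENT PER BAND (products): once one product pattern is placed in band `β`, the band
constant is the error of a product of data in that band. [folklore] -/
theorem mul_band_attained (R : Format) (B : PatBridge R (mulFuel X Y)) (β : ℕ)
    (hne : mulBandErrs B.err X Y R β ≠ []) :
    ∃ (a : MiniFloat X) (b : MiniFloat Y),
      2 ^ (R.manBits + β) * R.quantum ≤ |a.toRat * b.toRat| ∧
      |a.toRat * b.toRat| < 2 ^ (R.manBits + β + 1) * R.quantum ∧ |a.toRat * b.toRat| ≤ R.maxRat ∧
      |(B.fl (a.toRat * b.toRat)).toRat - a.toRat * b.toRat|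
        = maxList0 (mulBandErrs B.err X Y R β) * |a.toRat * b.toRat| := by
  have hmem := maxList0_mem_of_ne_nil hne (fun c hc => by
    obtain ⟨k₁, j₁, k₂, j₂, -, -, -, rfl⟩ := mem_mulBandErrs.mp hc
    exact B.err_nonneg _)
  obtain ⟨k₁, j₁, k₂, j₂, hk1, hk2, hp, hc⟩ := mem_mulBandErrs.mp hmem
  have hN : 0 < k₁ * k₂ := by
    rcases Nat.eq_zero_or_pos (k₁ * k₂) with h0 | h0
    · have h := (bandB_eq_true_iff.mp hp).1
      rw [h0, Nat.cast_zero, zero_mul] at h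
      exact absurd h (not_le.mpr (by positivity))
    · exact h0
  obtain ⟨a, b, ht, hsgn⟩ := exists_data_of_mem_sigShifts R hk1 hk2
    (Nat.pos_of_ne_zero fun h0 => by rw [h0, zero_mul] at hN; exact lt_irrefl 0 hN)
    (Nat.pos_of_ne_zero fun h0 => by rw [h0, mul_zero] at hN; exact lt_irrefl 0 hN)
    (B.sgn (k₁ * k₂))
  have hband := (bandB_iff_of_eq ht).mp hp
  have hlo := normal_of_band hband.1
  have hne0 := ne_zero_of_normal hlo
  have hrel := B.rel_eq _ _ _ hne0 hsgn
    (mul_lt_pow_mulFuel R (mem_sigShifts.mp hk1).1 (mem_sigShifts.mp hk2).1) ht hlo hband.2.2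
  refine ⟨a, b, hband.1, hband.2.1, hband.2.2, ?_⟩
  rw [hc]
  exact abs_sub_eq_mul_of_relErr_eq (abs_pos.mpr hne0) hrel

end MiniFloat

/-! ### Sums per band -/

/-- THE REALISABLE ALIGNED-SUM PATTERNS PLACED IN BAND `β`, with their errors. [folklore] -/
def addBandErrs (err : Format → ℕ → ℕ → ℚ) (X Y R : Format) (β : ℕ) : List ℚ :=
  X.sigShiftsC.flatMap fun p => Y.sigShiftsC.flatMap fun q => [false, true].flatMap fun opp =>
    if R.bandB β (addPatN p.1 ((p.2 : ℤ) + expOffset X R) q.1 ((q.2 : ℤ) + expOffset Y R) opp)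
        (min ((p.2 : ℤ) + expOffset X R) ((q.2 : ℤ) + expOffset Y R)) then
      [err R (addFuel X Y)
        (addPatN p.1 ((p.2 : ℤ) + expOffset X R) q.1 ((q.2 : ℤ) + expOffset Y R) opp)]
    else []

/-- Membership in `addBandErrs`. [folklore] -/
theorem mem_addBandErrs {err : Format → ℕ → ℕ → ℚ} {X Y R : Format} {β : ℕ} {c : ℚ} :
    c ∈ addBandErrs err X Y R β ↔ ∃ (k₁ j₁ k₂ j₂ : ℕ) (opp : Bool), (k₁, j₁) ∈ X.sigShiftsC ∧
      (k₂, j₂) ∈ Y.sigShiftsC ∧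
      R.bandB β (addPatN k₁ ((j₁ : ℤ) + expOffset X R) k₂ ((j₂ : ℤ) + expOffset Y R) opp)
        (min ((j₁ : ℤ) + expOffset X R) ((j₂ : ℤ) + expOffset Y R)) = true ∧
      c = err R (addFuel X Y)
        (addPatN k₁ ((j₁ : ℤ) + expOffset X R) k₂ ((j₂ : ℤ) + expOffset Y R) opp) := by
  simp only [addBandErrs, List.mem_flatMap]
  constructor
  · rintro ⟨⟨k₁, j₁⟩, h1, ⟨k₂, j₂⟩, h2, opp, -, h⟩
    split_ifs at h with hp
    · exact ⟨k₁, j₁, k₂, j₂, opp, h1, h2, hp, by simpa using h⟩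
    · simp at h
  · rintro ⟨k₁, j₁, k₂, j₂, opp, h1, h2, hp, rfl⟩
    exact ⟨(k₁, j₁), h1, (k₂, j₂), h2, opp, by cases opp <;> simp, by rw [if_pos hp]; simp⟩

/-- BAND CONSTANT, sums, nearest. [folklore] -/
def envconstAddBandNE (X Y R : Format) (β : ℕ) : ℚ := maxList0 (addBandErrs patRelErrNE X Y R β)

/-- BAND CONSTANT, sums, toward zero. [folklore] -/
def envconstAddBandTZ (X Y R : Format) (β : ℕ) : ℚ := maxList0 (addBandErrs patRelErrTZ X Y R β)

/-- BAND CONSTANT, sums, round down / round up. [folklore] -/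
def envconstAddBandDir (X Y R : Format) (β : ℕ) : ℚ :=
  maxList0 (addBandErrs patRelErrDir X Y R β)

namespace MiniFloat

variable {X Y : Format}

/-- The pattern of a sum in band `β` is listed there. [folklore] -/
theorem mem_addBandErrs_of_band (err : Format → ℕ → ℕ → ℚ) (R : Format) {β : ℕ}
    (a : MiniFloat X) (b : MiniFloat Y)
    (h1 : 2 ^ (R.manBits + β) * R.quantum ≤ |a.toRat + b.toRat|)
    (h2 : |a.toRat + b.toRat| < 2 ^ (R.manBits + β + 1) * R.quantum)
    (h3 : |a.toRat + b.toRat| ≤ R.maxRat) :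
    err R (addFuel X Y) (addPatN a.sig ((a.bshift : ℤ) + expOffset X R) b.sig
        ((b.bshift : ℤ) + expOffset Y R) (xor a.neg b.neg)) ∈ addBandErrs err X Y R β := by
  rw [mem_addBandErrs]
  exact ⟨a.sig, a.bshift, b.sig, b.bshift, xor a.neg b.neg, a.mem_sigShiftsC, b.mem_sigShiftsC,
    (bandB_iff_of_eq (abs_add_toRat_eq R a b)).mpr ⟨h1, h2, h3⟩, rfl⟩

/-- SOUNDNESS PER BAND (sums). [folklore] -/
theorem add_band_le (R : Format) (B : PatBridge R (addFuel X Y)) (β : ℕ) (a : MiniFloat X)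
    (b : MiniFloat Y) (h1 : 2 ^ (R.manBits + β) * R.quantum ≤ |a.toRat + b.toRat|)
    (h2 : |a.toRat + b.toRat| < 2 ^ (R.manBits + β + 1) * R.quantum)
    (h3 : |a.toRat + b.toRat| ≤ R.maxRat) :
    |(B.fl (a.toRat + b.toRat)).toRat - (a.toRat + b.toRat)|
      ≤ maxList0 (addBandErrs B.err X Y R β) * |a.toRat + b.toRat| := by
  have hlo := normal_of_band h1
  have hpos : 0 < |a.toRat + b.toRat| := abs_pos.mpr (ne_zero_of_normal hlo)
  have hrel := B.rel_le _ _ _ (addPatN_lt_pow R a.mem_sigShiftsC b.mem_sigShiftsC (xor a.neg b.neg))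
    (abs_add_toRat_eq R a b) hlo h3
  exact abs_sub_le_mul_of_relErr_le hpos
    (le_trans hrel (le_maxList0_of_mem (mem_addBandErrs_of_band B.err R a b h1 h2 h3)))

/-- ATTAINMENT PER BAND (sums). [folklore] -/
theorem add_band_attained (R : Format) (B : PatBridge R (addFuel X Y)) (β : ℕ)
    (hne : addBandErrs B.err X Y R β ≠ []) :
    ∃ (a : MiniFloat X) (b : MiniFloat Y),
      2 ^ (R.manBits + β) * R.quantum ≤ |a.toRat + b.toRat| ∧
      |a.toRat + b.toRat| < 2 ^ (R.manBits + β + 1) * R.quantum ∧ |a.toRat + b.toRat| ≤ R.maxRat ∧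
      |(B.fl (a.toRat + b.toRat)).toRat - (a.toRat + b.toRat)|
        = maxList0 (addBandErrs B.err X Y R β) * |a.toRat + b.toRat| := by
  have hmem := maxList0_mem_of_ne_nil hne (fun c hc => by
    obtain ⟨k₁, j₁, k₂, j₂, opp, -, -, -, rfl⟩ := mem_addBandErrs.mp hc
    exact B.err_nonneg _)
  obtain ⟨k₁, j₁, k₂, j₂, opp, hk1, hk2, hp, hc⟩ := mem_addBandErrs.mp hmem
  have hN : addPatN k₁ ((j₁ : ℤ) + expOffset X R) k₂ ((j₂ : ℤ) + expOffset Y R) opp ≠ 0 := by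
    intro h0
    have h := (bandB_eq_true_iff.mp hp).1
    rw [h0, Nat.cast_zero, zero_mul] at h
    exact absurd h (not_le.mpr (by positivity))
  obtain ⟨a, b, ht, hsgn⟩ := exists_data_add R hk1 hk2 opp (B.sgn _) hN
  have hband := (bandB_iff_of_eq ht).mp hp
  have hlo := normal_of_band hband.1
  have hne0 := ne_zero_of_normal hlo
  have hrel := B.rel_eq _ _ _ hne0 hsgn (addPatN_lt_pow R hk1 hk2 opp) ht hlo hband.2.2
  refine ⟨a, b, hband.1, hband.2.1, hband.2.2, ?_⟩
  rw [hc]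
  exact abs_sub_eq_mul_of_relErr_eq (abs_pos.mpr hne0) hrel

end MiniFloat

end Literature.ComputerArithmetic.FloatingPoint
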